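import Summits.BirchSwinnertonDyer.BirchSwinnertonDyer.Theorems.GenusKolyvaginAtTwoPowDvdShaCardAtTwoRTKolyvaginSuppliesOfDeepSwapPred
import Summits.BirchSwinnertonDyer.BirchSwinnertonDyer.Theorems.GenusKolyvaginAtTwoPowDvdShaCardAtTwoPosTKolyvaginMinimaTransposition
import HarnessLib

/-!
# Route `GenusKolyvaginAtTwo`, crux L⁺_T `PowDvdShaCardAtTwoPosT` (stmt-BirchSwinnertonDyer-23379), road (E4)⁺ — THE KS⁺ INTEGRATOR: Kolyvagin's
# depth supplies at 2 over the TRANSPOSITION-DEEP class, from the minima (proved) and the sockets hCheb / hbot⁺ / hswap⁺ / hK⁺ (sign-free twin of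
# `…RTKolyvaginSuppliesOfDeepSwapPred`)

Seat `bsd-line-gk2-p2` g22 (PROVER seat 2/3, cell `bsd-f1-sign2`), `--supports stmt-BirchSwinnertonDyer-25501` (helper; closes nothing).
THEOREMS ONLY (no definition, no named fact, no `sorry`).  BSD is NOT proved by any of this; neither is L⁺_T nor KS⁺ (its sockets are displayed).

WHY (LEAD R10/R10′: «(E4)⁺ owners = gk2-p2 (X-ORTH⁺, then swap⁺/KS⁺ assembly), gk2-p4 (hK⁺), gk2-p3 (hbot⁺); gk2-p5 g32 took swap⁺»).  The KS assembly of
road (E4) (`kolyvaginSuppliesAtTwo_of_deepSwap_pred`, gk2-p2 g20, over LEAD g17's minima and gk2-p2 g19's record clause) is sign-free EXCEPT for the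
minima's two Čebotarev inputs; `…PosTKolyvaginMinimaTransposition` (this seat) re-sources them (the regular supply for the empty family; a displayed socket
`hCheb` for the deep pair).  This file is the integrator over the transposition-deep class: the socket SHAPES below are the contracts for hbot⁺ / hswap⁺ /
hK⁺ (VERBATIM the Δ<0 shapes with the prime class `G`; instantiate `G q := L + k ≤ idx q ∧ TRANSP q`), and its output feeds the capstone with
`Xp = Xm := fun ℓ ↦ L + k ≤ Zhang2014.kolyvaginIndex W 2 ℓ ∧ TRANSP ℓ` — whose X-ORTH socket at `L = 2k'` is this seat's
`ctOrthogonalAtTwo_of_frame_transposition` (`…PosTXOrthTransposition`).  TRANSP (level-free): `∃ v 𝔓 (h : Γ_ℚ), ℓ ∈ v ∧ 𝔓 ∈ v.primesAbove ∧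
IsArithFrobAt (𝓞 ℚ) h 𝔓 ∧ ∃ u : E[2], h • u ≠ u`.

References: [McCallumLMS1991] §5 Prop. 5.2, Lemma 5.1, §4 Cor. 4.5, Lemma 4.6; [Kolyvagin1991MathAnn] Thm. 2.1–2.2; [GrossLMS1991] §3 (3.1)–(3.3), §4 (4.1).
-/

set_option autoImplicit false
-- the Theorems namespace of this sub repeats the summit name by design (D-0017 nested layout)
set_option linter.dupNamespace false

noncomputable section

open scoped Classical
open scoped AddSubgroup

namespace Summit.BirchSwinnertonDyer.BirchSwinnertonDyer.Theorems.GenusExact.PlusDescent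

open WeierstrassCurve NumberField IsDedekindDomain Field Literature.NumberTheory.EllipticCurves
  Literature.NumberTheory.GaloisRepresentations Literature.NumberTheory.EllipticCurves.ModularForms AddSubgroup
open Summit.BirchSwinnertonDyer.BirchSwinnertonDyer.Theses.GenusKolyvaginAtTwo (KolyvaginRelationAtTwo)
open Summit.BirchSwinnertonDyer.Rank1Residual

variable {K : Type} [Field K] [NumberField K]

/-- **KS⁺ INTEGRATOR (sign-free twin of `kolyvaginSuppliesAtTwo_of_deepSwap_pred`): Kolyvagin's depth supplies at `2` over the TRANSPOSITION-DEEP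
class, from the minima (PROVED, `RelaxedCount.exists_kolyvaginMinima_transposition`), the record clause (PROVED, sign-free:
`exists_recordLevel_avoiding_of_deepSwap`) and FOUR displayed sockets — `hCheb` (deep full-order signed pair Čebotarev at transposition-deep primes;
gk2-p5 g32), `hbot` (a 2-primitive bottom rung in the class; gk2-p3 hbot⁺ from the crux's transposition-deep witness), `hswap` (the exact prime swap
at transposition-deep primes; gk2-p5 g32 `deepSwap_socket_transposition`), `hK` (the eigen index law at a transposition-deep prime; gk2-p4 g24) — with
the supplied levels' primes REPORTED IN THE CLASS `Zhang ∧ L ≤ idx ∧ G` for any `G` implied by «index `≥ L + k` and transposition type».**  Output =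
VERBATIM the `(R, Mr, hMr, hMr0, hMrR, hOdd, hEven)` block consumed by the sign-free capstone
`pow_dvd_natCard_sha_of_kolyvaginSupplies_of_orthogonal_of_rank_le_one` (p741898).  Frame: `E/ℚ` globally minimal, non-CM, odd Tamagawa product,
`ρ_{E,2^∞}` onto — ANY sign of `Δ`; `K` imaginary quadratic, `d_K` odd `≠ −3`, Heegner; `τ ≠ 1`; Q2; (NPh) at level `2^(L+k)`.
(Proof adapted verbatim from gk2-p2 g20's `kolyvaginSuppliesAtTwo_of_deepSwap_pred`; one call changed.)
[cite: McCallumLMS1991, §5 Prop. 5.2, Lemma 5.1, §4 Cor. 4.5, Lemma 4.6] [cite: Kolyvagin1991MathAnn, Thm. 2.1] [cite: GrossLMS1991, §3 (3.1)–(3.3), §4 (4.1)] -/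
theorem kolyvaginSuppliesAtTwo_of_deepSwap_transposition (W : WeierstrassCurve ℚ) [W.IsElliptic] [W.IsGloballyMinimal] [NeZero (W.conductorNorm ℤ)]
    (hQ2 : KolyvaginRelationAtTwo) (hcm : ¬ W.HasCM) (hT : Odd W.tamagawaProduct)
    (hρ : ∀ m : ℕ, W.HasSurjectiveModNGaloisRep (2 ^ m : ℕ))
    (hIQ : IsImaginaryQuadratic K) (hodd : Odd (NumberField.discr K)) (h3 : NumberField.discr K ≠ -3)
    (hHe : SatisfiesHeegnerHypothesis (W.conductorNorm ℤ) K)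
    (τ : K ≃ₐ[ℚ] K) (hτ : τ ≠ 1)
    (Dt : ModularParametrizationData W (W.conductorNorm ℤ)) (β : ℤ) (ι : K →+* ℂ)
    (d₁ : KolyvaginHeegnerData Dt β ι 1) (M₀ : ℕ)
    (hM₀ : ∃ Q : (W.baseChange (ringClassField K ι 1)).toAffine.Point, ((2 ^ M₀ : ℕ) : ℤ) • Q = d₁.derivedPoint)
    (hndiv : ¬ ∃ Q : (W.baseChange (ringClassField K ι 1)).toAffine.Point, ((2 ^ (M₀ + 1) : ℕ) : ℤ) • Q = d₁.derivedPoint)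
    {L : ℕ} (hML : M₀ + 1 ≤ L) (k : ℕ)
    (hNPh : ∀ z : galH1Torsion (W.baseChange K) ((2 ^ (L + k) : ℕ) : ℤ),
      (∀ ρ' ∈ torsionFixing (W.baseChange K) ((2 ^ (L + k) : ℕ) : ℤ), h1Eval (W.baseChange K) ((2 ^ (L + k) : ℕ) : ℤ) z ρ' = 0) →
      (∀ w : HeightOneSpectrum (𝓞 K), z ∈ selmerLocalKer (W.baseChange K) (w.adicCompletion K) ((2 ^ (L + k) : ℕ) : ℤ)) → z = 0)
    (hCheb : ∀ (x y : galH1Torsion (W.baseChange K) ((2 ^ L : ℕ) : ℤ)) {m κ : ℕ}, 1 ≤ m → 1 ≤ κ →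
      addOrderOf x = 2 ^ m → addOrderOf y = 2 ^ κ → ∀ {sx sy : ℤ}, (sx = 1 ∨ sx = -1) → (sy = 1 ∨ sy = -1) →
      conjAct W τ ((2 ^ L : ℕ) : ℤ) x = sx • x → conjAct W τ ((2 ^ L : ℕ) : ℤ) y = sy • y →
      (∀ a b : ℤ, (∀ ρ ∈ torsionFixing (W.baseChange K) ((2 ^ (L + k) : ℕ) : ℤ),
        h1Eval (W.baseChange K) ((2 ^ (L + k) : ℕ) : ℤ)
          (torsionH1OfDvd (W.baseChange K) (natCast_pow_dvd_natCast_pow_add 2 L k) (a • x + b • y)) ρ = 0) → a • x + b • y = 0) →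
      ∀ X : Finset ℕ, ∃ ℓ : ℕ, ℓ ∉ X ∧ Zhang2014.IsKolyvaginPrime (W.conductorNorm ℤ) W K 2 ℓ ∧ L + k ≤ Zhang2014.kolyvaginIndex W 2 ℓ ∧
        (∃ (v : HeightOneSpectrum (𝓞 ℚ)) (𝔓 : Ideal (absIntegers (𝓞 ℚ) ℚ)) (h : absoluteGaloisGroup ℚ),
        (ℓ : 𝓞 ℚ) ∈ v.asIdeal ∧ 𝔓 ∈ v.primesAbove ∧ IsArithFrobAt (𝓞 ℚ) h 𝔓 ∧ ∃ u : geomTorsion W 2, h • u ≠ u) ∧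
        ∀ v : HeightOneSpectrum (𝓞 K), (ℓ : 𝓞 K) ∈ v.asIdeal →
          (∀ j : ℕ, ((2 ^ j : ℕ) : ℤ) • x ∈ (W.baseChange K).torsionLocalKer (v.adicCompletion K) ((2 ^ L : ℕ) : ℤ) ↔ m ≤ j) ∧
          ∀ j : ℕ, ((2 ^ j : ℕ) : ℤ) • y ∈ (W.baseChange K).torsionLocalKer (v.adicCompletion K) ((2 ^ L : ℕ) : ℤ) ↔ κ ≤ j)
    (G : ℕ → Prop)
    (hG : ∀ q : ℕ, Zhang2014.IsKolyvaginPrime (W.conductorNorm ℤ) W K 2 q → L + k ≤ Zhang2014.kolyvaginIndex W 2 q →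
      (∃ (v : HeightOneSpectrum (𝓞 ℚ)) (𝔓 : Ideal (absIntegers (𝓞 ℚ) ℚ)) (h : absoluteGaloisGroup ℚ),
        (q : 𝓞 ℚ) ∈ v.asIdeal ∧ 𝔓 ∈ v.primesAbove ∧ IsArithFrobAt (𝓞 ℚ) h 𝔓 ∧ ∃ u : geomTorsion W 2, h • u ≠ u) → G q)
    (hbot : ∃ (n : ℕ) (d : KolyvaginHeegnerData Dt β ι n), Squarefree n ∧
      (∀ q ∈ n.primeFactors, (Zhang2014.IsKolyvaginPrime (W.conductorNorm ℤ) W K 2 q ∧ L ≤ Zhang2014.kolyvaginIndex W 2 q) ∧ G q) ∧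
      addOrderOf (d.kolyvaginClass Nat.prime_two L) = 2 ^ L)
    (hswap : ∀ (r m : ℕ), 1 ≤ r → m < M₀ →
      (∀ (n : ℕ) (e : KolyvaginHeegnerData Dt β ι n), Squarefree n → n.primeFactors.card = r →
        (∀ q ∈ n.primeFactors, (Zhang2014.IsKolyvaginPrime (W.conductorNorm ℤ) W K 2 q ∧ L ≤ Zhang2014.kolyvaginIndex W 2 q) ∧ G q) →
        ((2 ^ (L - m) : ℕ) : ℤ) • e.kolyvaginClass Nat.prime_two L = 0) →
      ∀ (n : ℕ) (d : KolyvaginHeegnerData Dt β ι n), Squarefree n → n.primeFactors.card = r →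
      (∀ q ∈ n.primeFactors, (Zhang2014.IsKolyvaginPrime (W.conductorNorm ℤ) W K 2 q ∧ L ≤ Zhang2014.kolyvaginIndex W 2 q) ∧ G q) →
      addOrderOf (d.kolyvaginClass Nat.prime_two L) = 2 ^ (L - m) →
      ∀ ℓ₀ ∈ n.primeFactors, ∀ X : Finset ℕ, ∃ ℓ' : ℕ, ℓ' ∉ X ∧ ℓ' ∉ n.primeFactors ∧
        ((Zhang2014.IsKolyvaginPrime (W.conductorNorm ℤ) W K 2 ℓ' ∧ L ≤ Zhang2014.kolyvaginIndex W 2 ℓ') ∧ G ℓ') ∧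
        (∃ v : HeightOneSpectrum (𝓞 K), ((ℓ' : ℕ) : 𝓞 K) ∈ v.asIdeal ∧
          ((2 ^ (L - m - 1) : ℕ) : ℤ) • d.kolyvaginClass Nat.prime_two L ∉
            (W.baseChange K).torsionLocalKer (v.adicCompletion K) ((2 ^ L : ℕ) : ℤ)) ∧
        ∃ d' : KolyvaginHeegnerData Dt β ι (ℓ' * (n / ℓ₀)),
          ((2 ^ (L - m - 1) : ℕ) : ℤ) • d'.kolyvaginClass Nat.prime_two L ≠ 0)
    (hK : ∀ (r ℓ : ℕ), (Zhang2014.IsKolyvaginPrime (W.conductorNorm ℤ) W K 2 ℓ ∧ L ≤ Zhang2014.kolyvaginIndex W 2 ℓ) ∧ G ℓ →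
      ∀ C : AddSubgroup (galH1Torsion (W.baseChange K) ((2 ^ L : ℕ) : ℤ)),
      (∀ c ∈ C, c ∈ selmerGroup (W.baseChange K) ((2 ^ L : ℕ) : ℤ) ∧
        conjAct W τ ((2 ^ L : ℕ) : ℤ) c = (-W.rootNumber * (-1) ^ r) • c) →
      (⨅ (v : HeightOneSpectrum (𝓞 K)) (_ : ((ℓ : ℕ) : 𝓞 K) ∈ v.asIdeal),
          (W.baseChange K).torsionLocalKer (v.adicCompletion K) ((2 ^ L : ℕ) : ℤ)).relIndex
        (C ⊓ AddSubgroup.torsionBy (galH1Torsion (W.baseChange K) ((2 ^ L : ℕ) : ℤ)) (2 : ℤ)) ∣ 2) :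
    ∃ (R : ℕ) (Mr : ℕ → ℕ), (∀ j, Mr (j + 1) ≤ Mr j) ∧ Mr 0 = M₀ ∧ Mr R = 0 ∧
      (∀ m : ℕ, Mr (2 * m + 1) < Mr (2 * m) →
        ∀ (i : ℕ) (u : Fin i → galH1Torsion (W.baseChange K) ((2 ^ L : ℕ) : ℤ)), i ≤ 2 * m + 1 →
        (∀ j, u j ∈ selmerGroup (W.baseChange K) ((2 ^ L : ℕ) : ℤ) ∧
          conjAct W τ ((2 ^ L : ℕ) : ℤ) (u j) = W.rootNumber • u j) →
        ∃ (n : ℕ) (_ : Squarefree n)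
          (_ : ∀ ℓ ∈ n.primeFactors, Zhang2014.IsKolyvaginPrime (W.conductorNorm ℤ) W K 2 ℓ ∧ L ≤ Zhang2014.kolyvaginIndex W 2 ℓ ∧ G ℓ)
          (d : KolyvaginHeegnerData Dt β ι n),
          (∀ ℓ ∈ n.primeFactors, ∀ e : KolyvaginHeegnerData Dt β ι (n / ℓ),
            ((2 ^ (L - Mr (2 * m)) : ℕ) : ℤ) • e.kolyvaginClass Nat.prime_two L = 0) ∧
          addOrderOf (d.kolyvaginClass Nat.prime_two L) = 2 ^ (L - Mr (2 * m + 1)) ∧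
          -W.rootNumber * (-1) ^ n.primeFactors.card = W.rootNumber ∧
          Disjoint (zmultiples (((2 ^ (L - Mr (2 * m)) : ℕ) : ℤ) • d.kolyvaginClass Nat.prime_two L))
            (AddSubgroup.closure (Set.range u))) ∧
      (∀ m : ℕ, Mr (2 * m + 2) < Mr (2 * m + 1) →
        ∀ (i : ℕ) (u : Fin i → galH1Torsion (W.baseChange K) ((2 ^ L : ℕ) : ℤ)), i ≤ 2 * m + 1 →
        (∀ j, u j ∈ selmerGroup (W.baseChange K) ((2 ^ L : ℕ) : ℤ) ∧
          conjAct W τ ((2 ^ L : ℕ) : ℤ) (u j) = (-W.rootNumber) • u j) →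
        ∃ (n : ℕ) (_ : Squarefree n)
          (_ : ∀ ℓ ∈ n.primeFactors, Zhang2014.IsKolyvaginPrime (W.conductorNorm ℤ) W K 2 ℓ ∧ L ≤ Zhang2014.kolyvaginIndex W 2 ℓ ∧ G ℓ)
          (d : KolyvaginHeegnerData Dt β ι n),
          (∀ ℓ ∈ n.primeFactors, ∀ e : KolyvaginHeegnerData Dt β ι (n / ℓ),
            ((2 ^ (L - Mr (2 * m + 1)) : ℕ) : ℤ) • e.kolyvaginClass Nat.prime_two L = 0) ∧
          addOrderOf (d.kolyvaginClass Nat.prime_two L) = 2 ^ (L - Mr (2 * m + 2)) ∧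
          -W.rootNumber * (-1) ^ n.primeFactors.card = -W.rootNumber ∧
          Disjoint (zmultiples (((2 ^ (L - Mr (2 * m + 1)) : ℕ) : ℤ) • d.kolyvaginClass Nat.prime_two L))
            (AddSubgroup.closure (Set.range u) ⊔ zmultiples (d₁.kolyvaginClass Nat.prime_two L))) := by
  have hL1 : 1 ≤ L := by omega
  have hn0 : ((2 ^ L : ℕ) : ℤ) ≠ 0 := by positivity
  have hne4 : NumberField.discr K ≠ -4 := fun h ↦ by
    rw [h] at hodd
    exact (Int.not_even_iff_odd.mpr hodd) ⟨-2, by norm_num⟩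
  have hsurj1 : W.HasSurjectiveModNGaloisRep ((2 : ℤ) ^ 1) := by exact_mod_cast hρ 1
  -- the minima over the class
  obtain ⟨Mr, hstep, hMr0, hMrL, hkill, hatt, hzero⟩ := RelaxedCount.exists_kolyvaginMinima_transposition W hQ2 hcm hT hρ hIQ hodd h3 hHe
    τ hτ Dt β ι d₁ M₀ hM₀ hndiv hML k hNPh hCheb
    (fun X ↦ RelaxedCount.exists_transpositionDeep_notMem_finset W hIQ hodd hHe hρ τ hτ (by omega) X) G hG
  have hanti : ∀ a b, a ≤ b → Mr b ≤ Mr a := fun a b hab ↦ by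
    induction hab with
    | refl => exact le_rfl
    | step _ ih => exact (hstep _).trans ih
  have hMrM₀ : ∀ s, Mr s ≤ M₀ := fun s ↦ hMr0 ▸ hanti 0 s (Nat.zero_le s)
  -- the bottom rung
  obtain ⟨nb, db, hnb, hadmb, hordb⟩ := hbot
  have hMrR : Mr nb.primeFactors.card = 0 := hzero _ nb hnb rfl hadmb db hordb
  -- the annihilation one level down
  have hsub : ∀ (p : ℕ) (n : ℕ), Squarefree n →
      (∀ q ∈ n.primeFactors, (Zhang2014.IsKolyvaginPrime (W.conductorNorm ℤ) W K 2 q ∧ L ≤ Zhang2014.kolyvaginIndex W 2 q) ∧ G q) →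
      n.primeFactors.card = p + 1 → ∀ ℓ ∈ n.primeFactors, ∀ e : KolyvaginHeegnerData Dt β ι (n / ℓ),
        ((2 ^ (L - Mr p) : ℕ) : ℤ) • e.kolyvaginClass Nat.prime_two L = 0 := by
    intro p n hn hadm hcard ℓ hℓ e
    obtain ⟨hsq', hsubset, hcard'⟩ := squarefree_div_primeFactors' hn hℓ
    exact hkill p (n / ℓ) hsq' (by omega) (fun q hq ↦ hadm q (hsubset hq)) e
  -- the record clause at a drop `Mr (s+1) < Mr s`
  have hrecord : ∀ s : ℕ, Mr (s + 1) < Mr s →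
      ∀ (i : ℕ) (u : Fin i → galH1Torsion (W.baseChange K) ((2 ^ L : ℕ) : ℤ)), i ≤ s + 1 →
      (∀ j, u j ∈ selmerGroup (W.baseChange K) ((2 ^ L : ℕ) : ℤ) ∧
        conjAct W τ ((2 ^ L : ℕ) : ℤ) (u j) = (-W.rootNumber * (-1) ^ (s + 1)) • u j) →
      ∃ (n : ℕ) (_ : Squarefree n)
        (_ : ∀ q ∈ n.primeFactors, (Zhang2014.IsKolyvaginPrime (W.conductorNorm ℤ) W K 2 q ∧
          L ≤ Zhang2014.kolyvaginIndex W 2 q) ∧ G q)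
        (_ : n.primeFactors.card = s + 1) (d : KolyvaginHeegnerData Dt β ι n),
        addOrderOf (d.kolyvaginClass Nat.prime_two L) = 2 ^ (L - Mr (s + 1)) ∧
        Disjoint (zmultiples (((2 ^ (L - Mr s) : ℕ) : ℤ) • d.kolyvaginClass Nat.prime_two L))
          (AddSubgroup.closure (Set.range u)) := by
    intro s hdrop
    have hm : Mr (s + 1) < M₀ := lt_of_lt_of_le hdrop (hMrM₀ s)
    exact exists_recordLevel_avoiding_of_deepSwap W hQ2 hcm hT hρ hIQ hodd h3 hHe τ hτ Dt β ι G hL1 (by omega) hdrop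
      ((hMrL s).trans le_rfl) (fun n e hn hcard hadm ↦ hkill (s + 1) n hn hcard hadm e)
      (fun n e hn hcard hadm ↦ hkill s n hn (by omega) hadm e) (hatt (s + 1))
      (hswap (s + 1) (Mr (s + 1)) (by omega) hm (fun n e hn hcard hadm ↦ hkill (s + 1) n hn hcard hadm e)) (hK (s + 1))
  refine ⟨nb.primeFactors.card, Mr, hstep, hMr0, hMrR, fun m hm i u hi hu ↦ ?_, fun m hm i u hi hu ↦ ?_⟩
  · -- odd depth `2m + 1`, sign `w(E)`
    have hsign : -W.rootNumber * (-1) ^ (2 * m + 1) = W.rootNumber := by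
      rw [Odd.neg_one_pow ⟨m, rfl⟩]
      ring
    obtain ⟨n, hn, hadm, hcard, d, hord, hdisj⟩ := hrecord (2 * m) hm i u hi (fun j ↦ by rw [hsign]; exact hu j)
    refine ⟨n, hn, fun q hq ↦ ⟨(hadm q hq).1.1, (hadm q hq).1.2, (hadm q hq).2⟩, d, hsub (2 * m) n hn hadm hcard, hord, ?_, hdisj⟩
    rw [hcard]
    exact hsign
  · -- even depth `2m + 2`, sign `-w(E)`: McCallum's `C` generated by `u` AND the seed `c_L(1)`
    have hsign : -W.rootNumber * (-1) ^ (2 * m + 2) = -W.rootNumber := by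
      rw [Even.neg_one_pow ⟨m + 1, by ring⟩]
      ring
    have hdiv : ∀ P : geomPoints (W.baseChange K), ∃ Q : geomPoints (W.baseChange K), ((2 ^ L : ℕ) : ℤ) • Q = P :=
      (W.baseChange K).zsmul_geomPoints_surjective_of_charZero hn0
    obtain ⟨P₀, hP₀⟩ := McCallum1991.exists_map_eq_derivedPoint_one' hIQ d₁
    obtain ⟨hsel1, hc1, hsgn1⟩ := kummerMapTorsion_bottom_mem_selmerGroup_and_conjAct (W := W) (Dt := Dt) (β := β) (ι := ι)
      hIQ h3 hne4 hodd hHe hsurj1 τ hτ hL1 hdiv d₁ P₀ hP₀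
    rw [← hc1] at hsel1 hsgn1
    obtain ⟨n, hn, hadm, hcard, d, hord, hdisj⟩ := hrecord (2 * m + 1) hm (i + 1)
      (Fin.cons (d₁.kolyvaginClass Nat.prime_two L) u) (by omega) (fun j ↦ by
        rw [hsign]
        refine Fin.cases ?_ (fun j ↦ ?_) j
        · rw [Fin.cons_zero]
          exact ⟨hsel1, hsgn1⟩
        · rw [Fin.cons_succ]
          exact hu j)
    refine ⟨n, hn, fun q hq ↦ ⟨(hadm q hq).1.1, (hadm q hq).1.2, (hadm q hq).2⟩, d, hsub (2 * m + 1) n hn hadm hcard, hord, ?_, ?_⟩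
    · rw [hcard]
      exact hsign
    · refine hdisj.mono_right (sup_le ?_ ?_)
      · exact closure_mono (by
          rintro x ⟨j, rfl⟩
          exact ⟨j.succ, Fin.cons_succ _ _ _⟩)
      · exact zmultiples_le_of_mem (subset_closure ⟨0, Fin.cons_zero _ _⟩)

end Summit.BirchSwinnertonDyer.BirchSwinnertonDyer.Theorems.GenusExact.PlusDescent

end
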